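import Literature.Barriers.RiemannHypothesis.TuranPartialSumsSmoothedCesaro
import Literature.Barriers.RiemannHypothesis.TuranPartialSumsSmallN
import Mathlib.Analysis.SpecialFunctions.Trigonometric.Bounds
import HarnessLib

/-!
# Montgomery 1983 for the alternating sums `V_N`: twisted zeros beyond `1 + c log log N/log N`

Proofs-only companion of `Literature/Barriers/RiemannHypothesis/TuranPartialSums.lean` (named fact
`Literature.Barriers.RiemannHypothesis.montgomery1983_smoothedRemark`, Montgomery 1983, §1 p. 498: "our proof
of the Theorem, mutatis mutandis, applies to these functions [`C_N`, `V_N`, `A_N`] as well"). Three auxiliary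
definitions (the twisted alternating section, the factor `h(z) = 2a(2)2^{−z} − 1` of its generating series,
and the frozen kernel factor; concrete functions), no named facts.

For Montgomery's twist `a = montgomeryTwist m` and `P_N(s) = Σ_{n ≤ N} (−1)ⁿ a(n) n^{−s}` (generating series
`h(z) f(z)`, `LSeries_alternating_eq`):

* `montgomeryTwist_two` — `a(2) = i e^{iπθ₂}`, `θ₂ = log 2/2π` ((11) with `δ ≤ θ₂ ≤ 1 − δ`);
* `norm_altTwisted_sub_model_le` — the two-term model of §4 (24)–(25) on the box, with main term
  `h(s) f(s)`: from the truncated Perron formula at `x = N + ½` (`norm_perron_left_add_le`), the piece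
  decomposition of the line (`kernel_integral_eq_sum_gpieces`, factor `η̃(u) = h(s + α + iu)`), the line
  estimate (`norm_lineIntegral_sub_model_le`) and `tsum_perronWeight_le` for the truncation;
* `exists_altTwisted_zeros` — the closing argument (`exists_zero_of_good`, `eventually_good` with `ρ = h`,
  `H = 2`): hypothesis `hV` of `montgomery1983_smoothedRemark_of_twisted_zeros`.

## References

* [Montgomery1983] H. L. Montgomery, *Zeros of approximations to the zeta function*, Studies in Pure
  Mathematics (Turán memorial), Birkhäuser 1983, 497–506: §1 p. 498 (`V_N`), §2 (4), (11), §4 (24)–(25).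
-/

noncomputable section

open Complex Set Filter Topology MeasureTheory intervalIntegral Asymptotics
open scoped Interval

namespace Literature.Barriers.RiemannHypothesis

section Alt

variable (m : ℕ)

/-- The alternating section twisted by Montgomery's `a(n)`: `P_N(s) = Σ_{n ≤ N} (−1)ⁿ a(n) n^{−s}`.
[cite: Montgomery1983, §1 p. 498 and §2 (3)] -/
def altTwisted (N : ℕ) (s : ℂ) : ℂ :=
  ∑ n ∈ Finset.Icc 1 N, (-1 : ℂ) ^ n * montgomeryTwist m n * (n : ℂ) ^ (-s)

/-- The factor `h(z) = 2a(2)2^{−z} − 1` of the generating series `Σ (−1)ⁿ a(n) n^{−z} = h(z) f(z)`.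
[cite: Montgomery1983, §1 p. 498] -/
def altH (z : ℂ) : ℂ := 2 * montgomeryTwist m 2 * (2 : ℂ) ^ (-z) - 1

/-- The frozen kernel factor of the alternating model: `q_V(s) = h(1 + 1/Λ + i)/(1 + 1/Λ + i − s)`.
[cite: Montgomery1983, §4 (24)] -/
def altQ (Λ : ℝ) (s : ℂ) : ℂ := altH m (zline Λ 1) / (zline Λ 1 - s)

/-- `P_N` is entire. [folklore] -/
theorem differentiable_altTwisted (N : ℕ) : Differentiable ℂ (altTwisted m N) := by
  unfold altTwisted
  refine Differentiable.fun_sum fun n hn ↦ ?_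
  have hn0 : (n : ℂ) ≠ 0 := by
    rw [Finset.mem_Icc] at hn; exact_mod_cast (show n ≠ 0 by omega)
  exact (differentiable_const _).mul (differentiable_neg.const_cpow (Or.inl hn0))

/-- `2^{−z} = e^{−z log 2}`. [folklore] -/
theorem two_cpow_neg (z : ℂ) : (2 : ℂ) ^ (-z) = exp (-z * Real.log 2) := by
  rw [cpow_def_of_ne_zero two_ne_zero, show (2 : ℂ) = ((2 : ℝ) : ℂ) by norm_num, ← ofReal_log (by norm_num)]
  ring_nf

/-- `h` is entire, with `h'(z) = −2a(2) log 2 · 2^{−z}`. [folklore] -/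
theorem hasDerivAt_altH (z : ℂ) :
    HasDerivAt (altH m) (2 * montgomeryTwist m 2 * (exp (-z * Real.log 2) * -(Real.log 2 : ℂ))) z := by
  have h1 : HasDerivAt (fun z : ℂ ↦ exp (-z * Real.log 2)) (exp (-z * Real.log 2) * -(Real.log 2 : ℂ)) z := by
    have := ((hasDerivAt_neg z).mul_const (Real.log 2 : ℂ)).cexp
    simpa using this
  have h2 := (h1.const_mul (2 * montgomeryTwist m 2)).sub_const 1
  refine h2.congr_of_eventuallyEq (Eventually.of_forall fun w ↦ ?_)
  simp [altH, two_cpow_neg]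

/-- `h` is entire. [folklore] -/
theorem differentiable_altH : Differentiable ℂ (altH m) := fun z ↦ (hasDerivAt_altH m z).differentiableAt

/-- `|h(z)| ≤ 2` for `Re z ≥ 1`, and `|h'(z)| ≤ 1` there. [folklore] -/
theorem norm_altH_le {z : ℂ} (hz : 1 ≤ z.re) : ‖altH m z‖ ≤ 2 ∧ ‖deriv (altH m) z‖ ≤ 1 := by
  have ha : ‖montgomeryTwist m 2‖ ≤ 1 := norm_montgomeryTwist_le_one m 2
  have h2z : ‖(2 : ℂ) ^ (-z)‖ ≤ 1 / 2 := by
    rw [norm_two_cpow_neg]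
    calc (2 : ℝ) ^ (-z.re) ≤ (2 : ℝ) ^ (-1 : ℝ) := Real.rpow_le_rpow_of_exponent_le (by norm_num) (by linarith)
      _ = 1 / 2 := by rw [Real.rpow_neg_one]; norm_num
  have hlog2 : Real.log 2 ≤ 1 := by have := Real.log_two_lt_d9; linarith
  have hlog0 : 0 < Real.log 2 := Real.log_pos (by norm_num)
  constructor
  · unfold altH
    calc ‖2 * montgomeryTwist m 2 * (2 : ℂ) ^ (-z) - 1‖ ≤ ‖2 * montgomeryTwist m 2 * (2 : ℂ) ^ (-z)‖ + ‖(1 : ℂ)‖ :=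
          norm_sub_le _ _
      _ ≤ 2 * 1 * (1 / 2) + 1 := by
          rw [norm_mul, norm_mul, norm_one]
          refine add_le_add (mul_le_mul (mul_le_mul_of_nonneg_left ha (by norm_num) |>.trans_eq' (by simp))
            h2z (norm_nonneg _) (by norm_num)) le_rfl
      _ = 2 := by norm_num
  · have hn2 : ‖(2 : ℂ)‖ = 2 := by simp
    have hnl : ‖(Real.log 2 : ℂ)‖ = Real.log 2 := by rw [norm_real, Real.norm_eq_abs, abs_of_pos hlog0]
    rw [(hasDerivAt_altH m z).deriv, ← two_cpow_neg, norm_mul, norm_mul, norm_mul, norm_neg, hn2, hnl]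
    calc 2 * ‖montgomeryTwist m 2‖ * (‖(2 : ℂ) ^ (-z)‖ * Real.log 2) ≤ 2 * 1 * (1 / 2 * 1) := by
          refine mul_le_mul (mul_le_mul_of_nonneg_left ha (by norm_num)) (mul_le_mul h2z hlog2 hlog0.le
            (by norm_num)) (by positivity) (by norm_num)
      _ = 1 := by norm_num

/-- **`a(2) = i e^{iπθ₂}`**, `θ₂ = log 2/2π ∈ [δ, 1 − δ]` ((11): the second branch of `b_δ`, since
`δ ≤ 1/12 < log 2/2π < 1/8`). [cite: Montgomery1983, §2 (11)] -/
theorem montgomeryTwist_two :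
    montgomeryTwist m 2 = I * exp (((Real.pi * (Real.log 2 / (2 * Real.pi)) : ℝ) : ℂ) * I) := by
  have hδ := montgomeryDelta_pos m
  have hδ' := montgomeryDelta_le m
  have hl := Real.log_two_gt_d9
  have hl' := Real.log_two_lt_d9
  have hπ := Real.pi_gt_three
  have hπ' := Real.pi_lt_d2
  set θ : ℝ := Real.log 2 / (2 * Real.pi) with hθ
  have hθlo : 1 / 12 < θ := by rw [hθ, lt_div_iff₀ (by positivity)]; linarith
  have hθhi : θ < 1 / 8 := by rw [hθ, div_lt_iff₀ (by positivity)]; linarith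
  rw [montgomeryTwist_prime m Nat.prime_two, montgomeryPhase, montgomeryB, Nat.cast_ofNat,
    AddCircle.liftIco_coe_apply (by constructor <;> linarith), montgomeryProfile, if_neg (by linarith)]

/-- `Re a(2) = −sin(πθ₂) ≤ 0`, hence `|a(2) − 1| ≥ 1`. [cite: Montgomery1983, §2 (11)] -/
theorem one_le_norm_montgomeryTwist_two_sub_one : 1 ≤ ‖montgomeryTwist m 2 - 1‖ := by
  have hre : (montgomeryTwist m 2).re = -Real.sin (Real.pi * (Real.log 2 / (2 * Real.pi))) := by
    rw [montgomeryTwist_two, exp_mul_I, ← ofReal_cos, ← ofReal_sin]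
    set θ : ℝ := Real.pi * (Real.log 2 / (2 * Real.pi))
    have : I * ((Real.cos θ : ℂ) + (Real.sin θ : ℂ) * I) = ((-Real.sin θ : ℝ) : ℂ) + (Real.cos θ : ℂ) * I := by
      push_cast; ring_nf; rw [I_sq]; ring
    rw [this, add_re, ofReal_re, mul_I_re, ofReal_im, neg_zero, add_zero]
  have hsin : 0 ≤ Real.sin (Real.pi * (Real.log 2 / (2 * Real.pi))) := by
    refine Real.sin_nonneg_of_nonneg_of_le_pi (by positivity) ?_
    rw [show Real.pi * (Real.log 2 / (2 * Real.pi)) = Real.log 2 / 2 by field_simp]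
    linarith [Real.log_two_lt_d9, Real.pi_gt_three]
  calc (1 : ℝ) ≤ |(montgomeryTwist m 2 - 1).re| := by
        rw [sub_re, one_re, hre, abs_of_nonpos (by linarith)]; linarith
    _ ≤ ‖montgomeryTwist m 2 - 1‖ := abs_re_le_norm _

/-- **`h` near `1`**: for `Re s ≥ 1`, `|s − 1| ≤ 1/32`: `1/2 ≤ |h(s)| ≤ 3` and `|h'(s)| ≤ 1`
(`h(1) = a(2) − 1`, `|a(2) − 1| ∈ [1, 2]`, `|h(s) − h(1)| ≤ 4|s − 1|`). [cite: Montgomery1983, §2 (11)] -/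
theorem altH_near_one {s : ℂ} (hs : 1 ≤ s.re) (hs1 : ‖s - 1‖ ≤ 1 / 32) :
    1 / 2 ≤ ‖altH m s‖ ∧ ‖altH m s‖ ≤ 3 ∧ ‖deriv (altH m) s‖ ≤ 1 := by
  have ha : ‖montgomeryTwist m 2‖ ≤ 1 := norm_montgomeryTwist_le_one m 2
  have hlog0 : 0 < Real.log 2 := Real.log_pos (by norm_num)
  have hlog2 : Real.log 2 ≤ 1 := by have := Real.log_two_lt_d9; linarith
  -- `h(s) − h(1) = 2a(2)(2^{-s} − 1/2) = a(2) (e^{-(s-1) log 2} − 1)`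
  have h1 : altH m 1 = montgomeryTwist m 2 - 1 := by
    rw [altH, cpow_neg_one]; ring
  have hdiff : altH m s - altH m 1 = montgomeryTwist m 2 * (exp (-(s - 1) * Real.log 2) - 1) := by
    rw [altH, altH, two_cpow_neg, cpow_neg_one]
    have e1 : exp (-(Real.log 2 : ℂ)) = 1 / 2 := by
      rw [← ofReal_neg, ← ofReal_exp, Real.exp_neg, Real.exp_log two_pos]; norm_num
    have e2 : exp (-s * Real.log 2) = exp (-(s - 1) * Real.log 2) * exp (-(Real.log 2 : ℂ)) := by
      rw [← Complex.exp_add]; ring_nf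
    rw [e2, e1]; ring
  have hw : ‖-(s - 1) * (Real.log 2 : ℂ)‖ ≤ ‖s - 1‖ := by
    rw [norm_mul, norm_neg, norm_real, Real.norm_eq_abs, abs_of_pos hlog0]
    exact mul_le_of_le_one_right (norm_nonneg _) hlog2
  have hsmall : ‖altH m s - altH m 1‖ ≤ 2 * ‖s - 1‖ := by
    rw [hdiff, norm_mul]
    calc ‖montgomeryTwist m 2‖ * ‖exp (-(s - 1) * Real.log 2) - 1‖ ≤ 1 * (2 * ‖-(s - 1) * (Real.log 2 : ℂ)‖) :=
          mul_le_mul ha (norm_exp_sub_one_le (hw.trans (hs1.trans (by norm_num)))) (norm_nonneg _) zero_le_one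
      _ ≤ 2 * ‖s - 1‖ := by rw [one_mul]; exact mul_le_mul_of_nonneg_left hw (by norm_num)
  have hlo1 : 1 ≤ ‖altH m 1‖ := by rw [h1]; exact one_le_norm_montgomeryTwist_two_sub_one m
  have hhi1 : ‖altH m 1‖ ≤ 2 := by
    rw [h1]; exact (norm_sub_le _ _).trans (by rw [norm_one]; linarith)
  refine ⟨?_, ?_, (norm_altH_le m hs).2⟩
  · have := norm_sub_norm_le (altH m 1) (altH m s)
    rw [norm_sub_rev] at this
    linarith
  · have := norm_le_norm_add_norm_sub' (altH m s) (altH m 1)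
    have h2 := norm_sub_rev (altH m s) (altH m 1)
    linarith [norm_add_le (altH m 1) (altH m s - altH m 1), show altH m s = altH m 1 + (altH m s - altH m 1) by ring]

/-- **`h` at the first singularity**: `h(1 + 1/Λ + i) = 2r(sin c + i cos c) − 1` with
`r = 2^{−1−1/Λ}`, `c = log 2/2`, so `Im h(1 + 1/Λ + i) = 2r cos c ≥ cos(c)/2 ≥ 1/4`; hence
`1/4 ≤ |h(1 + 1/Λ + i)| ≤ 2`. [cite: Montgomery1983, §2 (11)] -/
theorem norm_altH_zline {Λ : ℝ} (hΛ : 1 ≤ Λ) : 1 / 4 ≤ ‖altH m (zline Λ 1)‖ ∧ ‖altH m (zline Λ 1)‖ ≤ 2 := by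
  have hΛ0 : 0 < Λ := by linarith
  set c : ℝ := Real.log 2 / 2 with hc
  set r : ℝ := Real.exp (-(1 + 1 / Λ) * Real.log 2) with hr
  have hπc : Real.pi * (Real.log 2 / (2 * Real.pi)) = c := by rw [hc]; field_simp
  have key : altH m (zline Λ 1) = ((2 * r * Real.sin c - 1 : ℝ) : ℂ) + ((2 * r * Real.cos c : ℝ) : ℂ) * I := by
    rw [altH, two_cpow_neg, montgomeryTwist_two, hπc, zline]
    have e : -(((1 + 1 / Λ : ℝ) : ℂ) + ((1 : ℝ) : ℂ) * I) * (Real.log 2 : ℂ) =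
        ((-(1 + 1 / Λ) * Real.log 2 : ℝ) : ℂ) + ((-(2 * c) : ℝ) : ℂ) * I := by
      rw [hc]; push_cast; ring
    rw [e, Complex.exp_add, ← ofReal_exp, ← hr]
    have e2 : exp ((c : ℂ) * I) * exp (((-(2 * c) : ℝ) : ℂ) * I) = exp (((-c : ℝ) : ℂ) * I) := by
      rw [← Complex.exp_add]; congr 1; push_cast; ring
    calc 2 * (I * exp ((c : ℂ) * I)) * ((r : ℂ) * exp (((-(2 * c) : ℝ) : ℂ) * I)) - 1
        = 2 * (r : ℂ) * I * (exp ((c : ℂ) * I) * exp (((-(2 * c) : ℝ) : ℂ) * I)) - 1 := by ring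
      _ = 2 * (r : ℂ) * I * exp (((-c : ℝ) : ℂ) * I) - 1 := by rw [e2]
      _ = _ := by
          rw [exp_mul_I, ← ofReal_cos, ← ofReal_sin, Real.cos_neg, Real.sin_neg]
          push_cast; ring_nf; rw [I_sq]; ring
  have him : (altH m (zline Λ 1)).im = 2 * r * Real.cos c := by
    rw [key, add_im, ofReal_im, mul_I_im, ofReal_re, zero_add]
  have hlog0 : 0 < Real.log 2 := Real.log_pos (by norm_num)
  have hr4 : 1 / 4 ≤ r := by
    have h4 : Real.exp (2 * Real.log 2) = 4 := by rw [two_mul, Real.exp_add, Real.exp_log two_pos]; norm_num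
    have h1 : 1 / Λ ≤ 1 := (div_le_one hΛ0).2 hΛ
    calc (1 : ℝ) / 4 = Real.exp (-(2 * Real.log 2)) := by rw [Real.exp_neg, h4]; norm_num
      _ ≤ r := by
          rw [hr]; refine Real.exp_le_exp.2 ?_
          have := mul_le_mul_of_nonneg_right (show 1 + 1 / Λ ≤ 2 by linarith) hlog0.le
          linarith
  have hcos : 9 / 10 ≤ Real.cos c := by
    have h1 : c ≤ 7 / 20 := by rw [hc]; linarith [Real.log_two_lt_d9]
    have h2 : 0 ≤ c := by rw [hc]; positivity
    have := Real.one_sub_sq_div_two_le_cos (x := c)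
    nlinarith
  constructor
  · calc (1 : ℝ) / 4 ≤ 2 * r * Real.cos c := by nlinarith
      _ = |(altH m (zline Λ 1)).im| := by rw [him, abs_of_nonneg (by nlinarith)]
      _ ≤ _ := abs_im_le_norm _
  · exact (norm_altH_le m (z := zline Λ 1) (by simp [zline]; positivity)).1

/-- **The frozen factor `q_V` on the box**: `1/8 ≤ |q_V| ≤ 3` and `q_V` is `4`-Lipschitz there.
[cite: Montgomery1983, §4 (24)–(25)] -/
theorem altQ_modelBox {Λ c₁ c₂ : ℝ} (hΛ : 20 ≤ Λ) (hc₁ : 12 ≤ c₁ * Real.log Λ)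
    (hc₂ : c₂ * Real.log Λ + 6 ≤ Λ / 2) {s s' : ℂ}
    (hs : s ∈ modelBox Λ (1 + c₁ * Real.log Λ / Λ) (1 + c₂ * Real.log Λ / Λ))
    (hs' : s' ∈ modelBox Λ (1 + c₁ * Real.log Λ / Λ) (1 + c₂ * Real.log Λ / Λ)) :
    (1 / 8 ≤ ‖altQ m Λ s‖ ∧ ‖altQ m Λ s‖ ≤ 3) ∧ ‖altQ m Λ s - altQ m Λ s'‖ ≤ 4 * ‖s - s'‖ := by
  obtain ⟨⟨hA1, hA2⟩, -, -, -⟩ := cesaroQ_modelBox hΛ hc₁ hc₂ hs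
  obtain ⟨⟨hA1', hA2'⟩, -, -, -⟩ := cesaroQ_modelBox hΛ hc₁ hc₂ hs'
  obtain ⟨hh1, hh2⟩ := norm_altH_zline m (Λ := Λ) (by linarith)
  set A := zline Λ 1 - s with hAdef
  set A' := zline Λ 1 - s' with hA'def
  set hz := altH m (zline Λ 1)
  have hA0 : A ≠ 0 := norm_pos_iff.1 (by linarith)
  have hA0' : A' ≠ 0 := norm_pos_iff.1 (by linarith)
  refine ⟨⟨?_, ?_⟩, ?_⟩
  · rw [altQ, norm_div, le_div_iff₀ (by linarith)]; nlinarith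
  · rw [altQ, norm_div, div_le_iff₀ (by linarith)]; nlinarith
  · have hdiff : altQ m Λ s - altQ m Λ s' = hz * (s - s') / (A * A') := by
      simp only [altQ, ← hAdef, ← hA'def]
      have hAA : A' = A - (s' - s) := by rw [hAdef, hA'def]; ring
      field_simp
      rw [hAA]; ring
    rw [hdiff, norm_div, norm_mul, norm_mul, div_le_iff₀ (by positivity)]
    have hden : (9 : ℝ) / 16 ≤ ‖A‖ * ‖A'‖ := by nlinarith
    calc ‖hz‖ * ‖s - s'‖ ≤ 2 * ‖s - s'‖ := mul_le_mul_of_nonneg_right hh2 (norm_nonneg _)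
      _ = (32 / 9) * ‖s - s'‖ * (9 / 16) := by ring
      _ ≤ (32 / 9) * ‖s - s'‖ * (‖A‖ * ‖A'‖) := mul_le_mul_of_nonneg_left hden (by positivity)
      _ ≤ 4 * ‖s - s'‖ * (‖A‖ * ‖A'‖) := by
          refine mul_le_mul_of_nonneg_right ?_ (by positivity); nlinarith [norm_nonneg (s - s')]

section ModelV

variable {A₁ A₂ A₃ A₄ : ℝ}
  (h18 : ∀ (k : ℤ) (z : ℂ), 1 < z.re → z.re ≤ 2 → |z.im - k| ≤ 1 / 2 →
    ‖montgomeryPhi m z + (montgomeryCoeff m k : ℂ) * log (z - 1 - k * I)‖ ≤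
      A₁ + A₂ * Real.log (Real.log (|(k : ℝ)| + 5)))
  (h19 : ∀ (k : ℤ) (z : ℂ), 1 < z.re → z.re ≤ 2 → |z.im - k| ≤ 1 / 2 →
    ‖montgomeryPhiDeriv m z + (montgomeryCoeff m k : ℂ) / (z - 1 - k * I)‖ ≤ A₃ + A₄ * Real.log (|(k : ℝ)| + 5))
include h18 h19

/-- **The two-term model for the twisted alternating sums.** Let `x = N + ½`, `Λ = log x ≥ max(20, L₁²)`,
`1 + 11/Λ ≤ Re s ≤ 3/2`, `|Im s| ≤ 5/Λ`, `K₀ ≥ 1`. Then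
`‖P_N(s) − h(s)f(s) − a₀ q_V(s) e^{−Λ(s−1)}‖ ≤ (e/2π)(lineErr(2, Λ, |α|/2, Λ^{-1/2}, K₀) + 2(8Λ+14)/K₀) e^{−Λ(Re s−1)}`
((24)–(25) for `V_N`: the truncated Perron formula (4)–(5) for the generating series `h(z)f(z)`, the line cut
into pieces with the bounded factor `h`, and the truncation error `x^α (1/T₁ + 1/T₂) Σ_n n^{−σ−α}/|log(x/n)|`
`≤ x^α (2/K₀)(8Λ + 14)`). [cite: Montgomery1983, §2 (4)–(5), §4 (24)–(25)] -/
theorem norm_altTwisted_sub_model_le (hA₂ : 0 ≤ A₂) (hA₃ : 0 ≤ A₃) (hA₄ : 0 ≤ A₄) {N : ℕ}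
    (hΛ20 : 20 ≤ Real.log ((N : ℝ) + 1 / 2)) (hΛL : (A₃ + A₄ * Real.log 6) ^ 2 ≤ Real.log ((N : ℝ) + 1 / 2))
    {s : ℂ} (hσ1 : 1 + 11 / Real.log ((N : ℝ) + 1 / 2) ≤ s.re) (hσ2 : s.re ≤ 3 / 2)
    (ht : |s.im| ≤ 5 / Real.log ((N : ℝ) + 1 / 2)) {K₀ : ℕ} (hK₀ : 1 ≤ K₀) :
    ‖altTwisted m N s - altH m s * montgomeryF m s -
        (exp ((Real.log ((N : ℝ) + 1 / 2) : ℂ) * I) *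
            ((Real.log ((N : ℝ) + 1 / 2) ^ (montgomeryCoeff m 1 - 1) / Real.Gamma (montgomeryCoeff m 1) : ℝ) : ℂ) *
            gOne m (Real.log ((N : ℝ) + 1 / 2)) 0) * altQ m (Real.log ((N : ℝ) + 1 / 2)) s *
          exp (-(Real.log ((N : ℝ) + 1 / 2) : ℂ) * (s - 1))‖ ≤
      Real.exp 1 / (2 * Real.pi) *
        (lineErr m A₁ A₂ A₃ A₄ 2 (Real.log ((N : ℝ) + 1 / 2)) (|1 + 1 / Real.log ((N : ℝ) + 1 / 2) - s.re| / 2)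
            ((Real.log ((N : ℝ) + 1 / 2)) ^ (-(1 / 2 : ℝ))) K₀ + 2 * (8 * Real.log ((N : ℝ) + 1 / 2) + 14) / K₀) *
        Real.exp (-Real.log ((N : ℝ) + 1 / 2) * (s.re - 1)) := by
  set x : ℝ := (N : ℝ) + 1 / 2 with hxdef
  set Λ := Real.log x with hΛdef
  have hΛ0 : 0 < Λ := by linarith
  have hx0 : 0 < x := by rw [hxdef]; positivity
  have hx1 : 1 < x := by
    by_contra h
    have := Real.log_nonpos hx0.le (not_lt.1 h)
    linarith
  have hN1 : 1 ≤ N := by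
    rcases Nat.eq_zero_or_pos N with h | h
    · exfalso; rw [h] at hxdef; rw [hxdef] at hx1; norm_num at hx1
    · exact h
  set σ := s.re with hσ
  set t := s.im with htdef
  set α : ℝ := 1 + 1 / Λ - σ with hα
  have hα0 : α < 0 := by
    rw [hα]; have : 1 / Λ < 11 / Λ := div_lt_div_of_pos_right (by norm_num) hΛ0; linarith
  have hα1 : -1 < α := by rw [hα]; have := one_div_pos.2 hΛ0; linarith
  have hσα : 1 < s.re + α := by rw [← hσ, hα]; have := one_div_pos.2 hΛ0; linarith
  have hρeq : s.re + α = 1 + 1 / Λ := by rw [← hσ, hα]; ring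
  have hre : ∀ u : ℝ, (s + α + u * I).re = 1 + 1 / Λ := by
    intro u; simp [← hσ, hα]
  have hre1 : ∀ u : ℝ, 1 < (s + α + u * I).re := fun u ↦ by rw [hre]; linarith [one_div_pos.2 hΛ0]
  have ht4 : |t| ≤ 1 / 4 := ht.trans (by rw [div_le_iff₀ hΛ0]; linarith)
  -- the coefficients `(−1)ⁿ a(n)` and their generating series `h f`
  set aV : ℕ → ℂ := fun n ↦ (-1 : ℂ) ^ n * montgomeryTwist m n with haV
  have haV1 : ∀ n, ‖aV n‖ ≤ 1 := by
    intro n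
    rw [haV]; dsimp only
    rw [norm_mul, norm_pow, norm_neg, norm_one, one_pow, one_mul]
    exact norm_montgomeryTwist_le_one m n
  have hgen : ∀ z : ℂ, 1 < z.re → LSeries aV z = altH m z * montgomeryF m z := fun z hz ↦
    LSeries_alternating_eq (ψ := fun n ↦ montgomeryTwist m n) (fun n ↦ montgomeryTwist_mul m 2 n)
      (norm_montgomeryTwist_le_one m) hz
  -- (1) the truncated Perron formula
  set T₁ : ℝ := (K₀ : ℝ) + 1 / 2 - t with hT₁
  set T₂ : ℝ := (K₀ : ℝ) + 1 / 2 + t with hT₂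
  have hK₀1 : (1 : ℝ) ≤ K₀ := by exact_mod_cast hK₀
  have hT₁K : (K₀ : ℝ) ≤ T₁ := by rw [hT₁]; linarith [(abs_le.1 ht4).2]
  have hT₂K : (K₀ : ℝ) ≤ T₂ := by rw [hT₂]; linarith [(abs_le.1 ht4).1]
  have hT₁pos : 0 < T₁ := by linarith
  have hT₂pos : 0 < T₂ := by linarith
  have hPerron := norm_perron_left_add_le haV1 hα0 hσα N hT₁pos hT₂pos
  have hsum : ∑ n ∈ Finset.Icc 1 N, aV n * (n : ℂ) ^ (-s) = altTwisted m N s := rfl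
  rw [hsum, ← hxdef] at hPerron
  -- the truncation weight
  have hW : ∑' n : ℕ, (n : ℝ) ^ (-(s.re + α)) / |Real.log (x / n)| ≤ 8 * Λ + 14 := by
    have h := (tsum_perronWeight_le hN1 hσα).2
    rw [← hxdef] at h
    refine h.trans ?_
    have h1 : (s.re + α) / (s.re + α - 1) = Λ + 1 := by
      rw [hρeq]; field_simp; ring
    have h2 : Real.log ((N + 1 : ℕ) : ℝ) ≤ Λ + 1 := by
      have hle : ((N + 1 : ℕ) : ℝ) ≤ Real.exp 1 * x := by
        push_cast; rw [hxdef]; nlinarith [Real.add_one_le_exp (1 : ℝ), (Nat.cast_nonneg N : (0 : ℝ) ≤ N)]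
      calc Real.log ((N + 1 : ℕ) : ℝ) ≤ Real.log (Real.exp 1 * x) := Real.log_le_log (by positivity) hle
        _ = Λ + 1 := by rw [Real.log_mul (Real.exp_pos 1).ne' hx0.ne', Real.log_exp, hΛdef]; ring
    rw [h1]; linarith
  have hWnn : 0 ≤ ∑' n : ℕ, (n : ℝ) ^ (-(s.re + α)) / |Real.log (x / n)| :=
    tsum_nonneg fun n ↦ by positivity
  -- (2) the kernel factor `η̃(u) = h(s + α + iu)`
  set ηt : ℝ → ℂ := fun u ↦ altH m (s + α + u * I) with hηt
  set ηt' : ℝ → ℂ := fun u ↦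
    2 * montgomeryTwist m 2 * (exp (-(s + α + u * I) * Real.log 2) * -(Real.log 2 : ℂ)) * I with hηt'
  have hηd : ∀ u : ℝ, HasDerivAt ηt (ηt' u) u := by
    intro u
    have hh : HasDerivAt (fun u : ℝ ↦ s + α + u * I) I u := by
      simpa using (((hasDerivAt_id (u : ℂ)).mul_const I).const_add (s + α)).comp_ofReal
    have := (hasDerivAt_altH m (s + α + u * I)).comp u hh
    simpa [hηt, hηt', Function.comp_def] using this
  have hηcont : Continuous ηt' := by simp only [hηt']; fun_prop
  have hηt_cont : Continuous ηt := by
    simp only [hηt]; exact (differentiable_altH m).continuous.comp (by fun_prop)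
  have hηb : ∀ u : ℝ, ‖ηt u‖ ≤ 2 := fun u ↦ (norm_altH_le m (hre1 u).le).1
  have hηb' : ∀ u : ℝ, ‖ηt' u‖ ≤ 2 := by
    intro u
    have h := (norm_altH_le m (hre1 u).le).2
    rw [(hasDerivAt_altH m _).deriv] at h
    simp only [hηt', norm_mul, norm_I, mul_one]
    rw [norm_mul, norm_mul, norm_mul] at h
    linarith
  -- (3) the middle part as a sum of pieces
  have hmid_congr : (∫ u in (-T₂)..T₁, LSeries aV (s + α + u * I) * ((x : ℂ) ^ ((α : ℂ) + u * I) / ((α : ℂ) + u * I))) =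
      ∫ u in (-T₂)..T₁, montgomeryF m (s + α + u * I) * (x : ℂ) ^ ((α : ℂ) + u * I) * (ηt u / ((α : ℂ) + u * I)) := by
    refine intervalIntegral.integral_congr fun u _ ↦ ?_
    simp only [hηt]
    rw [hgen _ (hre1 u)]; ring
  have hx2 : 2 ≤ Real.log x := by linarith
  have hσ' : s.re + α = 1 + 1 / Real.log x := hρeq
  have hpieces := kernel_integral_eq_sum_gpieces m hx1 hx2 hσ' hα0.ne hηt_cont K₀
  rw [← hT₁, ← hT₂] at hpieces
  -- (4) the line estimate
  have hmodel := norm_lineIntegral_sub_model_le m h18 h19 hA₂ hA₃ hA₄ hx1 hΛ20 hΛL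
    (s := s) hσ1 hσ2 ht (H := 2) (by norm_num) hηd hηcont hηb hηb' hK₀
  -- (5) identification of `q`
  have hd' : s + α + ((1 - t : ℝ) : ℂ) * I = zline Λ 1 := by
    rw [hα, zline, ← re_add_im s, ← hσ, ← htdef]
    push_cast; ring
  have hq : ηt (1 - t) / (zline Λ 1 - s) = altQ m Λ s := by
    simp only [hηt]; rw [hd', altQ]
  -- (6) assembling
  have hxα : x ^ α = Real.exp 1 * Real.exp (-Λ * (σ - 1)) := by
    rw [Real.rpow_def_of_pos hx0, ← hΛdef, ← Real.exp_add]
    congr 1; rw [hα]; field_simp; ring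
  rw [← htdef] at hmodel hpieces
  rw [← hα, hq] at hmodel
  set S := ∑ i ∈ Finset.range (2 * K₀ + 1), ∫ v in (-(1 / 2))..(1 / 2),
    gpiece m Λ α t (fun v ↦ (x : ℂ) ^ (((((i : ℤ) - K₀ : ℤ) : ℝ) - t : ℝ) * I) *
      ηt ((((i : ℤ) - K₀ : ℤ) : ℝ) + v - t)) ((i : ℤ) - K₀) v * exp (((Λ * v : ℝ) : ℂ) * I) with hS
  set A : ℂ := exp ((Λ : ℂ) * I) *
    ((Λ ^ (montgomeryCoeff m 1 - 1) / Real.Gamma (montgomeryCoeff m 1) : ℝ) : ℂ) * gOne m Λ 0 with hA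
  set E : ℂ := exp (-(Λ : ℂ) * (s - 1)) with hE
  set I₁ := ∫ u in (-T₂)..T₁, LSeries aV (s + α + u * I) * ((x : ℂ) ^ ((α : ℂ) + u * I) / ((α : ℂ) + u * I))
    with hI₁
  set R := I₁ + 2 * Real.pi * (LSeries aV s - altTwisted m N s) with hR
  have hmid : (1 / (2 * (Real.pi : ℂ))) * I₁ = (((x ^ α / (2 * Real.pi)) : ℝ) : ℂ) * S := by
    rw [hmid_congr, hpieces, ← Complex.ofReal_cpow hx0.le]
    push_cast
    ring
  have hπ0 : (Real.pi : ℂ) ≠ 0 := ofReal_ne_zero.2 Real.pi_pos.ne'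
  have halt : altTwisted m N s = LSeries aV s + (1 / (2 * (Real.pi : ℂ))) * I₁ - (1 / (2 * (Real.pi : ℂ))) * R := by
    rw [hR]; field_simp; ring
  have hL : LSeries aV s = altH m s * montgomeryF m s := hgen s (by rw [← hσ]; linarith [div_pos (by norm_num : (0:ℝ) < 11) hΛ0])
  have hdecomp : altTwisted m N s - altH m s * montgomeryF m s - A * altQ m Λ s * E =
      ((((x ^ α / (2 * Real.pi)) : ℝ) : ℂ) * S - A * altQ m Λ s * E) - (1 / (2 * (Real.pi : ℂ))) * R := by
    rw [halt, hL, hmid]; ring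
  rw [hdecomp]
  have hnorm_coef : ‖(1 / (2 * (Real.pi : ℂ)))‖ = 1 / (2 * Real.pi) := by
    rw [show (1 / (2 * (Real.pi : ℂ))) = (((1 / (2 * Real.pi)) : ℝ) : ℂ) by push_cast; ring, norm_real,
      Real.norm_eq_abs, abs_of_pos (by positivity)]
  have hK₀pos : (0 : ℝ) < K₀ := by linarith
  have hTT : 1 / T₁ + 1 / T₂ ≤ 2 / K₀ := by
    have h1 : 1 / T₁ ≤ 1 / K₀ := one_div_le_one_div_of_le hK₀pos hT₁K
    have h2 : 1 / T₂ ≤ 1 / K₀ := one_div_le_one_div_of_le hK₀pos hT₂K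
    have h3 : (2 : ℝ) / K₀ = 1 / K₀ + 1 / K₀ := by ring
    linarith
  have hRle : ‖R‖ ≤ x ^ α * (2 / K₀) * (8 * Λ + 14) := by
    refine hPerron.trans ?_
    exact mul_le_mul (mul_le_mul_of_nonneg_left hTT (Real.rpow_nonneg hx0.le _)) hW hWnn (by positivity)
  calc ‖((((x ^ α / (2 * Real.pi)) : ℝ) : ℂ) * S - A * altQ m Λ s * E) - (1 / (2 * (Real.pi : ℂ))) * R‖
      ≤ ‖(((x ^ α / (2 * Real.pi)) : ℝ) : ℂ) * S - A * altQ m Λ s * E‖ + ‖(1 / (2 * (Real.pi : ℂ))) * R‖ :=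
        norm_sub_le _ _
    _ ≤ Real.exp 1 / (2 * Real.pi) * lineErr m A₁ A₂ A₃ A₄ 2 Λ (|α| / 2) (Λ ^ (-(1 / 2 : ℝ))) K₀ *
            Real.exp (-Λ * (σ - 1)) + 1 / (2 * Real.pi) * (x ^ α * (2 / K₀) * (8 * Λ + 14)) := by
        refine add_le_add hmodel ?_
        rw [norm_mul, hnorm_coef]
        exact mul_le_mul_of_nonneg_left hRle (by positivity)
    _ = _ := by rw [hxα]; ring

end ModelV

/-- **Twisted alternating zeros beyond `1 + c log log N/log N`** (hypothesis `hV` of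
`montgomery1983_smoothedRemark_of_twisted_zeros`): for some `c > 0` and all large `N` there is a completely
multiplicative `ψ`, unimodular at the primes — Montgomery's `a(n)` for a suitable `δ` — and a zero `s₀` of
`Σ_{n ≤ N} (−1)ⁿ ψ(n) n^{−s}` with `Re s₀ > 1 + c log log N/log N` (the Theorem of the source for `V_N`,
"mutatis mutandis"; the passage from `Λ = log(N + ½)` to `log N` costs nothing).
[cite: Montgomery1983, §1 p. 498 and §4] -/
theorem exists_altTwisted_zeros :
    ∃ c : ℝ, 0 < c ∧ ∃ N₀ : ℕ, ∀ N : ℕ, N₀ < N → ∃ ψ : ℕ → ℂ,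
      (∀ m n : ℕ, m ≠ 0 → n ≠ 0 → ψ (m * n) = ψ m * ψ n) ∧ (∀ p : ℕ, p.Prime → ‖ψ p‖ = 1) ∧
      ∃ s₀ : ℂ, twistedPartialSum (fun n ↦ (-1 : ℂ) ^ n * ψ n) N s₀ = 0 ∧
        1 + c * Real.log (Real.log N) / Real.log N < s₀.re := by
  obtain ⟨m, hm⟩ := exists_lt_montgomeryCoeff_one_sub_zero (c := 0) (by
    rw [lt_sub_iff_add_lt, zero_add, lt_div_iff₀ Real.pi_pos]; linarith [Real.pi_lt_four])
  obtain ⟨A₁, A₂, -, hA₂, h18⟩ := exists_norm_phi_add_log_le m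
  obtain ⟨A₃, A₄, hA₃, hA₄, h19⟩ := exists_norm_phiDeriv_add_inv_le m
  obtain ⟨ε₁, hε₁, hev⟩ := eventually_good m (A₁ := A₁) hA₂ hA₃ hA₄ hm (H := 2) (q₀ := 1 / 8) (q₁ := 3)
    (Lq := 4) (ρ₁ := 1 / 2) (ρ₂ := 3) (ρ₃ := 1) (by norm_num) (by norm_num) (by norm_num) (by norm_num)
    (by norm_num) zero_le_one
  set cs := montgomeryCoeff m 1 - montgomeryCoeff m 0 - 1 with hcs
  have hc₁pos : 0 < cs / 2 := by linarith
  -- transfer to `N → ∞` along `Λ = log (N + 1/2)`, together with `log N ≥ 2`, `c₁ log log N ≥ 2`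
  have hlogN : Tendsto (fun N : ℕ ↦ Real.log (N : ℝ)) atTop atTop :=
    Real.tendsto_log_atTop.comp tendsto_natCast_atTop_atTop
  have hlogx : Tendsto (fun N : ℕ ↦ Real.log ((N : ℝ) + 1 / 2)) atTop atTop :=
    Real.tendsto_log_atTop.comp (tendsto_atTop_add_const_right _ _ tendsto_natCast_atTop_atTop)
  have Ea : ∀ᶠ N : ℕ in atTop, 2 ≤ cs / 2 * Real.log (Real.log (N : ℝ)) :=
    ((Real.tendsto_log_atTop.comp hlogN).const_mul_atTop hc₁pos).eventually_ge_atTop 2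
  have Eb : ∀ᶠ N : ℕ in atTop, 2 ≤ Real.log (N : ℝ) := hlogN.eventually_ge_atTop 2
  have Ec : ∀ᶠ N : ℕ in atTop, 1 ≤ N := eventually_ge_atTop 1
  obtain ⟨N₀, hN₀⟩ := eventually_atTop.1 ((hlogx.eventually hev).and (Ea.and (Eb.and Ec)))
  refine ⟨cs / 4, by linarith, N₀, fun N hN ↦ ⟨fun n ↦ montgomeryTwist m n,
    fun a b _ _ ↦ montgomeryTwist_mul m a b, fun p hp ↦ norm_montgomeryTwist_prime m hp, ?_⟩⟩
  obtain ⟨⟨g1, g2, g3, g4, g5, g6, g7, g8⟩, ha, hb, hc⟩ := hN₀ N hN.le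
  set Λ := Real.log ((N : ℝ) + 1 / 2) with hΛ
  set L := Real.log (N : ℝ) with hL
  have hΛ0 : 0 < Λ := by linarith
  have hc₁' : 12 ≤ cs / 2 * Real.log Λ := g3
  have hc₂' : (cs + 1) * Real.log Λ + 6 ≤ Λ / 2 := by linarith
  -- the model hypothesis, with the truncation absorbed into `44 Λ^{-2}`
  have hK₀1 : 1 ≤ ⌈Λ ^ 3⌉₊ := Nat.one_le_ceil_iff.2 (by positivity)
  have htail : 2 * (8 * Λ + 14) / (⌈Λ ^ 3⌉₊ : ℕ) ≤ 44 * Λ ^ (-2 : ℝ) := by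
    have hK : Λ ^ 3 ≤ ((⌈Λ ^ 3⌉₊ : ℕ) : ℝ) := Nat.le_ceil _
    have hKpos : (0 : ℝ) < ((⌈Λ ^ 3⌉₊ : ℕ) : ℝ) := by exact_mod_cast hK₀1
    rw [div_le_iff₀ hKpos]
    have h2 : Λ ^ (-2 : ℝ) * Λ ^ 3 = Λ := by
      rw [show (Λ ^ 3 : ℝ) = Λ ^ (3 : ℝ) by norm_cast, ← Real.rpow_add hΛ0]; norm_num
    calc 2 * (8 * Λ + 14) ≤ 44 * Λ := by linarith
      _ = 44 * Λ ^ (-2 : ℝ) * Λ ^ 3 := by rw [mul_assoc, h2]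
      _ ≤ 44 * Λ ^ (-2 : ℝ) * ((⌈Λ ^ 3⌉₊ : ℕ) : ℝ) := mul_le_mul_of_nonneg_left hK (by positivity)
  have hmodel : ∀ s ∈ modelBox Λ (1 + cs / 2 * Real.log Λ / Λ) (1 + (cs + 1) * Real.log Λ / Λ),
      ‖altTwisted m N s - altH m s * montgomeryF m s -
        (exp ((Λ : ℂ) * I) * ((Λ ^ (montgomeryCoeff m 1 - 1) / Real.Gamma (montgomeryCoeff m 1) : ℝ) : ℂ) *
          gOne m Λ 0) * altQ m Λ s * exp (-(Λ : ℂ) * (s - 1))‖ ≤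
      Real.exp 1 / (2 * Real.pi) *
        (lineErr m A₁ A₂ A₃ A₄ 2 Λ (|1 + 1 / Λ - s.re| / 2) (Λ ^ (-(1 / 2 : ℝ))) ⌈Λ ^ 3⌉₊ + 44 * Λ ^ (-2 : ℝ)) *
        Real.exp (-Λ * (s.re - 1)) := by
    intro s hs
    obtain ⟨h1, h2, h3, -⟩ := modelBox_basic g1 hc₁' hc₂' hs
    have hM := norm_altTwisted_sub_model_le m h18 h19 hA₂ hA₃ hA₄ g1 g2 h1 h2 h3 hK₀1
    refine hM.trans (mul_le_mul_of_nonneg_right (mul_le_mul_of_nonneg_left (add_le_add le_rfl htail)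
      (by positivity)) (Real.exp_pos _).le)
  have hρb : ∀ s ∈ modelBox Λ (1 + cs / 2 * Real.log Λ / Λ) (1 + (cs + 1) * Real.log Λ / Λ),
      1 / 2 ≤ ‖altH m s‖ ∧ ‖altH m s‖ ≤ 3 ∧ ‖deriv (altH m) s‖ ≤ 1 := by
    intro s hs
    obtain ⟨h1, -, -, -, h5, -⟩ := modelBox_basic g1 hc₁' hc₂' hs
    refine altH_near_one m (by linarith [div_pos (by norm_num : (0:ℝ) < 11) hΛ0]) (h5.trans ?_)
    rw [div_le_iff₀ hΛ0]; linarith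
  obtain ⟨s, hs0, hsre⟩ := exists_zero_of_good m h18 h19 hm hε₁.le (by norm_num) (by norm_num) (by norm_num)
    (by norm_num) zero_le_one (differentiable_altTwisted m N).differentiableOn (differentiable_altH m).differentiableOn
    hρb
    (fun s hs ↦ (altQ_modelBox m g1 hc₁' hc₂' hs hs).1)
    (fun s hs s' hs' ↦ (altQ_modelBox m g1 hc₁' hc₂' hs hs').2) hmodel g1 g3 g4 g5 g6 g7 g8
  refine ⟨s, hs0, lt_of_le_of_lt ?_ hsre⟩
  -- from `Λ = log (N + 1/2)` to `L = log N`: `1 + (c*/4) log L/L ≤ 1 + c₁ log Λ/Λ − 1/(2Λ)`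
  have hN1 : (1 : ℝ) ≤ N := by exact_mod_cast hc
  have hL0 : 0 < L := by linarith
  have hLΛ : L ≤ Λ := Real.log_le_log (by linarith) (by linarith)
  have hΛL1 : Λ ≤ L + 1 := by
    have hle : (N : ℝ) + 1 / 2 ≤ Real.exp 1 * N := by nlinarith [Real.add_one_le_exp (1 : ℝ)]
    calc Λ ≤ Real.log (Real.exp 1 * N) := Real.log_le_log (by positivity) hle
      _ = L + 1 := by rw [Real.log_mul (Real.exp_pos 1).ne' (by positivity), Real.log_exp, hL]; ring
  have hll : Real.log L ≤ Real.log Λ := Real.log_le_log hL0 hLΛ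
  set y := cs / 2 * Real.log L with hy
  have hy2 : 2 ≤ y := ha
  have hyΛ : y ≤ cs / 2 * Real.log Λ := mul_le_mul_of_nonneg_left hll hc₁pos.le
  have step1 : cs / 4 * Real.log L / L = (y / 2) / L := by rw [hy]; ring
  have step2 : (y / 2) / L ≤ (y - 1 / 2) / (L + 1) := by
    rw [div_le_div_iff₀ hL0 (by linarith)]; nlinarith
  have step3 : (y - 1 / 2) / (L + 1) ≤ (cs / 2 * Real.log Λ - 1 / 2) / Λ :=
    calc (y - 1 / 2) / (L + 1) ≤ (cs / 2 * Real.log Λ - 1 / 2) / (L + 1) :=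
          div_le_div_of_nonneg_right (by linarith) (by linarith)
      _ ≤ (cs / 2 * Real.log Λ - 1 / 2) / Λ := div_le_div_of_nonneg_left (by linarith) hΛ0 hΛL1
  rw [step1, show 1 + cs / 2 * Real.log Λ / Λ - 1 / (2 * Λ) = 1 + (cs / 2 * Real.log Λ - 1 / 2) / Λ by
    field_simp; ring]
  linarith

end Alt

end Literature.Barriers.RiemannHypothesis

end
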